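import Summits.NavierStokesRegularity.NavierStokesRegularity.Theorems.EfficiencyFloorNearSaturationNearMaximiserSeqCoreHeatLaplacian
import HarnessLib

/-!
# Route `EfficiencyFloor`, crux `NearSaturationNearMaximiser` (stmt-NavierStokesRegularity-25482) on the
# `ProductionEfficiencyDecay` ladder (stmt-22866): THE MOLLIFICATION ESTIMATE FROM ITS UNIFORM-IN-TIME FORM (Fatou at `a → 0⁺`)

Def-free helper file, nineteenth of the group. The last d-free hypothesis (HM) of `nearSaturationNearMaximiser_of_mollification_of_identification`
(`…SeqCoreHeatContinuity`) asks for `∫‖g − e^{tΔ}g‖² ≤ C_m·t·∫‖Dg‖²`. Its natural proof bounds `∫‖e^{tΔ}g − e^{aΔ}g‖²` UNIFORMLY in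
`0 < a ≤ t` (time integral of `Δe^{σΔ}g`, `…SeqCoreHeatLaplacian`) and lets `a → 0⁺`. This file does the passage to the limit:
`e^{aΔ}g(x) → g(x)` pointwise (`tendsto_heatExtension_nhdsGT_zero_of_continuousAt`) and FATOU (`lintegral_liminf_le'`).

* `mollification_of_uniform` — (HM) ⟸ (HMa): `∃ C, ∀ g ∈ C¹, g, Dg ∈ L², ∀ 0 < a ≤ t, ∫‖e^{tΔ}g − e^{aΔ}g‖² ≤ C·t·∫‖Dg‖²`;
* `nearSaturationNearMaximiser_of_uniformMollification_of_identification` — BY NAME: stmt-25482 ⟸ (HMa) ∧ (I).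

HONEST FRAMING: (HMa) (weighted Cauchy–Schwarz in time + Tonelli over `∫‖Δe^{σΔ}g‖² ≤ 72σ⁻¹∫‖Dg‖²`) is NOT yet proved; (I) is open;
stmt-25482, `LerayFloorGap`, `ProductionEfficiencyDecay` (stmt-22866) and Navier–Stokes regularity stay OPEN; no summit statement is proved. [folklore]
-/

-- the problem directory repeats the summit name (`NavierStokesRegularity/NavierStokesRegularity`)
set_option linter.dupNamespace false

noncomputable section

namespace Summit.NavierStokesRegularity.NavierStokesRegularity.Theorems

namespace NearSaturationNearMaximiser

namespace SeqCore

open Set MeasureTheory Filter Topology Function Real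
open scoped InnerProductSpace ENNReal NNReal
open Literature.Analysis.UnboundedOperators

/-- **The mollification estimate from its uniform-in-time form** (Fatou at `a → 0⁺`). [folklore] -/
theorem mollification_of_uniform
    (HMa : ∃ C : ℝ, ∀ g : EuclideanSpace ℝ (Fin 3) → EuclideanSpace ℝ (Fin 3), ContDiff ℝ 1 g →
      Integrable (fun x => ‖g x‖ ^ 2) → Integrable (fun x => ‖fderiv ℝ g x‖ ^ 2) → ∀ a t : ℝ, 0 < a → a ≤ t →
        ∫ x, ‖heatExtension g t x - heatExtension g a x‖ ^ 2 ≤ C * t * ∫ x, ‖fderiv ℝ g x‖ ^ 2) :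
    ∃ Cm : ℝ, ∀ g : EuclideanSpace ℝ (Fin 3) → EuclideanSpace ℝ (Fin 3), ContDiff ℝ 1 g →
      Integrable (fun x => ‖g x‖ ^ 2) → Integrable (fun x => ‖fderiv ℝ g x‖ ^ 2) → ∀ t : ℝ, 0 < t →
        Integrable (fun x => ‖g x - heatExtension g t x‖ ^ 2) ∧
          ∫ x, ‖g x - heatExtension g t x‖ ^ 2 ≤ Cm * t * ∫ x, ‖fderiv ℝ g x‖ ^ 2 := by
  obtain ⟨C, hC⟩ := HMa
  refine ⟨C, fun g hg I2 ID t ht => ?_⟩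
  have hg2 : MemLp g 2 volume := (memLp_two_iff_integrable_sq_norm hg.continuous.aestronglyMeasurable).2 I2
  have mE : ∀ {s : ℝ}, 0 < s → MemLp (heatExtension g s) 2 volume := fun hs =>
    memLp_heatExtension_holds (E := EuclideanSpace ℝ (Fin 3)) (F := EuclideanSpace ℝ (Fin 3)) hg2 one_le_two hs
  have hcE : ∀ {s : ℝ}, 0 < s → Continuous (heatExtension g s) := fun hs =>
    (contDiff_heatExtension_holds (E := EuclideanSpace ℝ (Fin 3)) (F := EuclideanSpace ℝ (Fin 3)) hg2 one_le_two hs).continuous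
  have hI : Integrable (fun x => ‖g x - heatExtension g t x‖ ^ 2) := integrable_norm_sq_of_memLp_two (hg2.sub (mE ht))
  refine ⟨hI, ?_⟩
  set B : ℝ := C * t * ∫ x, ‖fderiv ℝ g x‖ ^ 2 with hB
  have hB0 : 0 ≤ B := (integral_nonneg fun x => by positivity).trans (hC g hg I2 ID t t ht le_rfl)
  -- the family `f a = ‖e^{tΔ}g − e^{aΔ}g‖²` (as `ℝ≥0∞`, junk `0` for `a ≤ 0`)
  set f : ℝ → EuclideanSpace ℝ (Fin 3) → ℝ≥0∞ := fun a x =>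
    if 0 < a then ENNReal.ofReal (‖heatExtension g t x - heatExtension g a x‖ ^ 2) else 0 with hf
  have hfm : ∀ a, AEMeasurable (f a) volume := by
    intro a
    by_cases ha : 0 < a
    · have e : f a = fun x => ENNReal.ofReal (‖heatExtension g t x - heatExtension g a x‖ ^ 2) := by
        funext x; simp only [hf, if_pos ha]
      rw [e]
      exact (((hcE ht).sub (hcE ha)).norm.pow 2).measurable.ennreal_ofReal.aemeasurable
    · have e : f a = fun _ => 0 := by funext x; simp only [hf, if_neg ha]
      rw [e]; exact aemeasurable_const
  have h1 : ∀ᶠ a in 𝓝[>] (0 : ℝ), 0 < a := eventually_mem_nhdsWithin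
  have h2 : ∀ᶠ a in 𝓝[>] (0 : ℝ), a ≤ t := mem_nhdsWithin_of_mem_nhds (Iic_mem_nhds ht)
  -- pointwise limit `a → 0⁺`
  have hptw : ∀ x, Tendsto (fun a => f a x) (𝓝[>] 0) (𝓝 (ENNReal.ofReal (‖heatExtension g t x - g x‖ ^ 2))) := by
    intro x
    have h0 := tendsto_heatExtension_nhdsGT_zero_of_continuousAt hg2 one_le_two (hg.continuous.continuousAt (x := x))
    have h := ENNReal.tendsto_ofReal (((tendsto_const_nhds (x := heatExtension g t x)).sub h0).norm.pow 2)
    refine h.congr' (h1.mono fun a ha => ?_)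
    simp only [hf, if_pos ha]
  -- Fatou
  have hfatou := lintegral_liminf_le' (μ := (volume : Measure (EuclideanSpace ℝ (Fin 3)))) hfm (u := 𝓝[>] (0 : ℝ))
  have hL : ∫⁻ x, ENNReal.ofReal (‖heatExtension g t x - g x‖ ^ 2) = ∫⁻ x, liminf (fun a => f a x) (𝓝[>] (0 : ℝ)) :=
    lintegral_congr fun x => ((hptw x).liminf_eq).symm
  have hR : liminf (fun a => ∫⁻ x, f a x) (𝓝[>] (0 : ℝ)) ≤ ENNReal.ofReal B := by
    refine liminf_le_of_frequently_le ((h1.and h2).mono fun a ha => ?_).frequently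
    obtain ⟨ha, hat⟩ := ha
    have hI' : Integrable (fun x => ‖heatExtension g t x - heatExtension g a x‖ ^ 2) :=
      integrable_norm_sq_of_memLp_two ((mE ht).sub (mE ha))
    have e : (fun x => f a x) = fun x => ENNReal.ofReal (‖heatExtension g t x - heatExtension g a x‖ ^ 2) := by
      funext x; simp only [hf, if_pos ha]
    rw [e, ← ofReal_integral_eq_lintegral_ofReal hI' (ae_of_all _ fun x => by positivity)]
    exact ENNReal.ofReal_le_ofReal (hC g hg I2 ID a t ha hat)
  have hmain : ∫⁻ x, ENNReal.ofReal (‖heatExtension g t x - g x‖ ^ 2) ≤ ENNReal.ofReal B := by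
    rw [hL]; exact hfatou.trans hR
  -- back to the Bochner integral
  have hI2 : Integrable (fun x => ‖heatExtension g t x - g x‖ ^ 2) := integrable_norm_sq_of_memLp_two ((mE ht).sub hg2)
  have e1 : ∫ x, ‖g x - heatExtension g t x‖ ^ 2 = ∫ x, ‖heatExtension g t x - g x‖ ^ 2 :=
    integral_congr_ae (ae_of_all _ fun x => by
      show ‖g x - heatExtension g t x‖ ^ 2 = ‖heatExtension g t x - g x‖ ^ 2
      rw [norm_sub_rev])
  rw [e1, integral_eq_lintegral_of_nonneg_ae (ae_of_all _ fun x => by positivity) hI2.aestronglyMeasurable]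
  calc (∫⁻ x, ENNReal.ofReal (‖heatExtension g t x - g x‖ ^ 2)).toReal ≤ (ENNReal.ofReal B).toReal :=
        ENNReal.toReal_mono ENNReal.ofReal_ne_top hmain
    _ = B := ENNReal.toReal_ofReal hB0

/-- **`NearSaturationNearMaximiser` (stmt-25482) from the uniform-in-time mollification bound and the regularity of the limit
profile, BY NAME.** (HM) of `nearSaturationNearMaximiser_of_mollification_of_identification` replaced by (HMa) via
`mollification_of_uniform`. [folklore] -/
theorem nearSaturationNearMaximiser_of_uniformMollification_of_identification
    (HMa : ∃ C : ℝ, ∀ g : EuclideanSpace ℝ (Fin 3) → EuclideanSpace ℝ (Fin 3), ContDiff ℝ 1 g →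
      Integrable (fun x => ‖g x‖ ^ 2) → Integrable (fun x => ‖fderiv ℝ g x‖ ^ 2) → ∀ a t : ℝ, 0 < a → a ≤ t →
        ∫ x, ‖heatExtension g t x - heatExtension g a x‖ ^ 2 ≤ C * t * ∫ x, ‖fderiv ℝ g x‖ ^ 2)
    (HI : ∀ c : ℝ, (0 < c ∧ (∀ v : EuclideanSpace ℝ (Fin 3) → EuclideanSpace ℝ (Fin 3), (ContDiff ℝ (⊤ : ℕ∞) v ∧
      Literature.Analysis.FluidPDE.VectorCalculus.IsDivFree v ∧ (∫⁻ x, ‖iteratedFDeriv ℝ 0 v x‖ₑ ^ 2 < ⊤) ∧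
      (∫⁻ x, ‖iteratedFDeriv ℝ 1 v x‖ₑ ^ 2 < ⊤) ∧ (∫⁻ x, ‖iteratedFDeriv ℝ 2 v x‖ₑ ^ 2 < ⊤)) → (∫ x,
      ⟪Literature.Analysis.FluidPDE.curl v x, fderiv ℝ v x (Literature.Analysis.FluidPDE.curl v x)⟫_ℝ) ≤ c *
      (∫ x, ‖Literature.Analysis.FluidPDE.curl v x‖ ^ 2) ^ (3 / 4 : ℝ) * (∫ x,
      Literature.Analysis.FluidPDE.frobeniusNormSq (fderiv ℝ (Literature.Analysis.FluidPDE.curl v) x)) ^ (3 / 4 : ℝ)) ∧ ∀ c' : ℝ, (∀ w : EuclideanSpace ℝ (Fin 3) → EuclideanSpace ℝ (Fin 3), (ContDiff ℝ (⊤ : ℕ∞) w ∧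
      Literature.Analysis.FluidPDE.VectorCalculus.IsDivFree w ∧ (∫⁻ x, ‖iteratedFDeriv ℝ 0 w x‖ₑ ^ 2 < ⊤) ∧
      (∫⁻ x, ‖iteratedFDeriv ℝ 1 w x‖ₑ ^ 2 < ⊤) ∧ (∫⁻ x, ‖iteratedFDeriv ℝ 2 w x‖ₑ ^ 2 < ⊤)) → (∫ x,
      ⟪Literature.Analysis.FluidPDE.curl w x, fderiv ℝ w x (Literature.Analysis.FluidPDE.curl w x)⟫_ℝ) ≤ c' *
      (∫ x, ‖Literature.Analysis.FluidPDE.curl w x‖ ^ 2) ^ (3 / 4 : ℝ) * (∫ x,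
      Literature.Analysis.FluidPDE.frobeniusNormSq (fderiv ℝ (Literature.Analysis.FluidPDE.curl w) x)) ^ (3 / 4 : ℝ)) → c ≤ c') →
      ∀ K δ : ℝ, 0 < K → 0 < δ → ∀ v : ℕ → EuclideanSpace ℝ (Fin 3) → EuclideanSpace ℝ (Fin 3),
      (∀ n, (ContDiff ℝ (⊤ : ℕ∞) (v n) ∧
      Literature.Analysis.FluidPDE.VectorCalculus.IsDivFree (v n) ∧ (∫⁻ x, ‖iteratedFDeriv ℝ 0 (v n) x‖ₑ ^ 2 < ⊤) ∧
      (∫⁻ x, ‖iteratedFDeriv ℝ 1 (v n) x‖ₑ ^ 2 < ⊤) ∧ (∫⁻ x, ‖iteratedFDeriv ℝ 2 (v n) x‖ₑ ^ 2 < ⊤))) →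
      (∀ n, (∫ x, ‖Literature.Analysis.FluidPDE.curl (v n) x‖ ^ 2) = 1) →
      (∀ n, (∫ x, Literature.Analysis.FluidPDE.frobeniusNormSq (fderiv ℝ (Literature.Analysis.FluidPDE.curl (v n)) x)) = 1) →
      Tendsto (fun n => ∫ x, ⟪Literature.Analysis.FluidPDE.curl (v n) x, fderiv ℝ (v n) x
        (Literature.Analysis.FluidPDE.curl (v n) x)⟫_ℝ) atTop (𝓝 c) →
      (∀ᶠ n in atTop, δ ≤ ∫ x in Metric.ball (0 : EuclideanSpace ℝ (Fin 3)) K, ‖Literature.Analysis.FluidPDE.curl (v n) x‖ ^ 2) →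
      ∀ (φ₀ : ℕ → ℕ) (M : Fin 3 → EuclideanSpace ℝ (Fin 3) → EuclideanSpace ℝ (Fin 3))
        (Ω : EuclideanSpace ℝ (Fin 3) → EuclideanSpace ℝ (Fin 3)), StrictMono φ₀ →
      (∀ j, MemLp (M j) 2 volume) →
      (∀ (j : Fin 3) (ψ : EuclideanSpace ℝ (Fin 3) → EuclideanSpace ℝ (Fin 3)), MemLp ψ 2 volume →
        Tendsto (fun k => ∫ x, ⟪fderiv ℝ (v (φ₀ k)) x (EuclideanSpace.basisFun (Fin 3) ℝ j), ψ x⟫_ℝ) atTop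
          (𝓝 (∫ x, ⟪M j x, ψ x⟫_ℝ))) →
      MemLp Ω 2 volume →
      (∀ R : ℝ, 0 < R → Tendsto (fun k => ∫ x in Metric.ball (0 : EuclideanSpace ℝ (Fin 3)) R,
          ‖Literature.Analysis.FluidPDE.curl (v (φ₀ k)) x - Ω x‖ ^ 2) atTop (𝓝 0)) →
      ∃ w : EuclideanSpace ℝ (Fin 3) → EuclideanSpace ℝ (Fin 3), (ContDiff ℝ (⊤ : ℕ∞) w ∧
      Literature.Analysis.FluidPDE.VectorCalculus.IsDivFree w ∧ (∫⁻ x, ‖iteratedFDeriv ℝ 0 w x‖ₑ ^ 2 < ⊤) ∧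
      (∫⁻ x, ‖iteratedFDeriv ℝ 1 w x‖ₑ ^ 2 < ⊤) ∧ (∫⁻ x, ‖iteratedFDeriv ℝ 2 w x‖ₑ ^ 2 < ⊤)) ∧
        (∀ j : Fin 3, (fun x => fderiv ℝ w x (EuclideanSpace.basisFun (Fin 3) ℝ j)) =ᵐ[volume] M j) ∧
        Literature.Analysis.FluidPDE.curl w =ᵐ[volume] Ω) :
    Summit.NavierStokesRegularity.NavierStokesRegularity.Theses.EfficiencyFloor.NearSaturationNearMaximiser :=
  nearSaturationNearMaximiser_of_mollification_of_identification (mollification_of_uniform HMa) HI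

end SeqCore

end NearSaturationNearMaximiser

end Summit.NavierStokesRegularity.NavierStokesRegularity.Theorems

end
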